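import Summits.CriticalPhenomena.PercolationContinuityZ3.Theorems.PercNearOneGluingNoHeavyLowerTailTwoPortPeelingLevelTwoIffs
import Summits.CriticalPhenomena.PercolationContinuityZ3.Theorems.PercNearOneGluingNoHeavyLowerTailTwoPortPeelingComonotoneAlgebra
import Summits.CriticalPhenomena.PercolationContinuityZ3.Theorems.PercNearOneGluingNoHeavyLowerTailTwoPortPeelingTools
import Summits.CriticalPhenomena.PercolationContinuityZ3.Theorems.PercNearOneGluingAdditiveGluingOneBond
import Summits.CriticalPhenomena.PercolationContinuityZ3.Theorems.PercNearOneGluingAdditiveGluingLincombIntegral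
import Summits.CriticalPhenomena.PercolationContinuityZ3.Theorems.PercNearOneGluingAdditiveGluingTieLiftOne
import Literature.Probability.LatticeModels.ProdBernoulliAtomExpansion
import HarnessLib

/-!
# `NoHeavyLowerTail` (stmt-CriticalPhenomena-4575) — two-port peeling: the comonotone certificate integrated (level `j ≤ 2`)

Route `PercNearOneGluingNoHeavy`, seat `prim-gen-swap` (gen 5); memo TWO-PORT-PEELING.md §5 (P2), §7.
`TwoPortPeeling.comonotone_nonneg_levelTwo`: for two two-port stars `u = {a, a'}`, `v = {b, b'}` over `A` (hubs outside
`A`, ports distinct, `c ∈ A` off the ports) and `j ≤ 2`, if `c` beats `a` and `b` as an observer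
(`P(R_a) ≤ P(R_c)`, `P(R_b) ≤ P(R_c)`, `R_x = {x lonely}`), then the quantity `(1 − θ_u)·h_∅ + θ_u·h_{aa'}` of
`championStabilityPair_twoStars_of_comonotone` is nonnegative.  Proof: write every world measure as the base measure
(all four port pairs closed) of a glue preimage, expand `P(R_x)` by the relay law at both hubs, and integrate the
pointwise certificate `comonotone_pointwise_abstract` fed with the level-2 translations `iffs_base_u / iffs_v / iffs_w`
(valid almost surely: the hubs carry no other open pair).  No definitions, no named facts, no sorries.
-/

noncomputable section

namespace Summit.CriticalPhenomena.PercolationContinuityZ3.Theorems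

open MeasureTheory Set Literature.Probability.LatticeModels Literature.Probability.Percolation
open scoped Classical BigOperators

variable {n : ℕ}

namespace TwoPortPeeling

/-- Opening two distinct pairs: `P_{p[e↦1][e'↦1]}(S) = P_{p[e↦0][e'↦0]}({ω | insert e (insert e' ω) ∈ S})`. [folklore] -/
theorem real_update_two_pull (p : Sym2 (Fin n) → unitInterval) {e e' : Sym2 (Fin n)} (hee' : e ≠ e')
    (S : Set (BondConfig (Fin n))) :
    (prodBernoulli (Function.update (Function.update p e 1) e' 1)).real S =
      (prodBernoulli (Function.update (Function.update p e 0) e' 0)).real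
        ((fun ω : BondConfig (Fin n) => insert e (insert e' ω)) ⁻¹' S) := by
  rw [Function.update_comm hee', tieLiftOne_real_one_eq, Function.update_comm hee'.symm, tieLiftOne_real_one_eq]
  rfl

/-- Commuting two pairs of updates at four distinct keys. [folklore] -/
theorem update_comm4 (p : Sym2 (Fin n) → unitInterval) {e₁ e₂ e₃ e₄ : Sym2 (Fin n)}
    (h13 : e₁ ≠ e₃) (h14 : e₁ ≠ e₄) (h23 : e₂ ≠ e₃) (h24 : e₂ ≠ e₄) (x₁ x₂ x₃ x₄ : unitInterval) :
    Function.update (Function.update (Function.update (Function.update p e₁ x₁) e₂ x₂) e₃ x₃) e₄ x₄ =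
      Function.update (Function.update (Function.update (Function.update p e₃ x₃) e₄ x₄) e₁ x₁) e₂ x₂ := by
  ext i
  simp only [Function.update_apply]
  by_cases h1 : i = e₁ <;> by_cases h2 : i = e₂ <;> by_cases h3 : i = e₃ <;> by_cases h4 : i = e₄ <;>
    simp_all

/-- Integrating an almost-sure certificate: if `0 ≤ Σ_i c_i 1[E_i]` almost surely under `P_w`, then
`0 ≤ Σ_i c_i P_w(E_i)` (list form, cf. `stub_lincombIntegral_c7`). [folklore] -/
theorem lincomb_nonneg_of_ae (w : Sym2 (Fin n) → unitInterval) (l : List (ℝ × Set (BondConfig (Fin n))))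
    (h : ∀ᵐ ω ∂(prodBernoulli w), 0 ≤ (l.map fun ce => ce.1 * ce.2.indicator (1 : BondConfig (Fin n) → ℝ) ω).sum) :
    0 ≤ (l.map fun ce => ce.1 * (prodBernoulli w).real ce.2).sum := by
  rw [← lincombIntegral_integral_eq w l]
  exact integral_nonneg_of_ae h

/-- Under the base weights (both port pairs of both hubs closed) every pair at a hub has weight `0`. [this file] -/
theorem hubPairs_weight_zero (w : Sym2 (Fin n) → unitInterval) (A : Finset (Fin n)) (u v a a' b b' : Fin n)
    (hu : u ∉ A) (hv : v ∉ A) (huv : u ≠ v) (ha : a ∈ A) (ha' : a' ∈ A) (hb : b ∈ A) (hb' : b' ∈ A)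
    (haa' : a ≠ a') (hbb' : b ≠ b')
    (hutwo : ∀ y : Fin n, y ≠ u → y ≠ a → y ≠ a' → w s(u, y) = 0)
    (hvtwo : ∀ y : Fin n, y ≠ v → y ≠ b → y ≠ b' → w s(v, y) = 0) :
    ∀ i ∈ (((Finset.univ.filter fun y : Fin n => y ≠ u).image fun y => (s(u, y) : Sym2 (Fin n))) ∪
      ((Finset.univ.filter fun y : Fin n => y ≠ v).image fun y => (s(v, y) : Sym2 (Fin n)))),
      (((Function.update (Function.update (Function.update (Function.update w s(v, b) 0) s(v, b') 0) s(u, a) 0) s(u, a') 0) i : unitInterval) : ℝ) = 0 := by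
  have hua : u ≠ a := fun h => hu (h ▸ ha)
  have hua' : u ≠ a' := fun h => hu (h ▸ ha')
  have hub : u ≠ b := fun h => hu (h ▸ hb)
  have hub' : u ≠ b' := fun h => hu (h ▸ hb')
  have hva : v ≠ a := fun h => hv (h ▸ ha)
  have hva' : v ≠ a' := fun h => hv (h ▸ ha')
  have hvb' : v ≠ b' := fun h => hv (h ▸ hb')
  have png : ∀ {p q r t : Fin n}, (p ≠ r ∨ q ≠ t) → (p ≠ t ∨ q ≠ r) → (s(p, q) : Sym2 (Fin n)) ≠ s(r, t) := by
    intro p q r t h1 h2 h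
    rw [Sym2.eq_iff] at h
    rcases h with ⟨h3, h4⟩ | ⟨h3, h4⟩
    · rcases h1 with h1 | h1
      · exact h1 h3
      · exact h1 h4
    · rcases h2 with h2 | h2
      · exact h2 h3
      · exact h2 h4
  have nUA : (s(u, a) : Sym2 (Fin n)) ≠ s(u, a') := png (Or.inr haa') (Or.inl hua')
  have nVB : (s(v, b) : Sym2 (Fin n)) ≠ s(v, b') := png (Or.inr hbb') (Or.inl hvb')
  have nUyB : ∀ y : Fin n, (s(u, y) : Sym2 (Fin n)) ≠ s(v, b) := fun y => png (Or.inl huv) (Or.inl hub)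
  have nUyB' : ∀ y : Fin n, (s(u, y) : Sym2 (Fin n)) ≠ s(v, b') := fun y => png (Or.inl huv) (Or.inl hub')
  have nVyA : ∀ y : Fin n, (s(v, y) : Sym2 (Fin n)) ≠ s(u, a) := fun y => png (Or.inl huv.symm) (Or.inl hva)
  have nVyA' : ∀ y : Fin n, (s(v, y) : Sym2 (Fin n)) ≠ s(u, a') := fun y => png (Or.inl huv.symm) (Or.inl hva')
  intro i hi
  rcases Finset.mem_union.1 hi with hi | hi
  · obtain ⟨y, hy, rfl⟩ := Finset.mem_image.1 hi
    have hyu : y ≠ u := (Finset.mem_filter.1 hy).2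
    by_cases hya' : y = a'
    · subst hya'; simp
    by_cases hya : y = a
    · subst hya
      rw [Function.update_of_ne nUA]; simp
    have h1 : (s(u, y) : Sym2 (Fin n)) ≠ s(u, a') := fun h => hya' (Sym2.congr_right.1 h)
    have h2 : (s(u, y) : Sym2 (Fin n)) ≠ s(u, a) := fun h => hya (Sym2.congr_right.1 h)
    rw [Function.update_of_ne h1, Function.update_of_ne h2, Function.update_of_ne (nUyB' y),
      Function.update_of_ne (nUyB y), hutwo y hyu hya hya']
    rfl
  · obtain ⟨y, hy, rfl⟩ := Finset.mem_image.1 hi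
    have hyv : y ≠ v := (Finset.mem_filter.1 hy).2
    rw [Function.update_of_ne (nVyA' y), Function.update_of_ne (nVyA y)]
    by_cases hyb' : y = b'
    · subst hyb'; simp
    by_cases hyb : y = b
    · subst hyb
      rw [Function.update_of_ne nVB]; simp
    have h1 : (s(v, y) : Sym2 (Fin n)) ≠ s(v, b') := fun h => hyb' (Sym2.congr_right.1 h)
    have h2 : (s(v, y) : Sym2 (Fin n)) ≠ s(v, b) := fun h => hyb (Sym2.congr_right.1 h)
    rw [Function.update_of_ne h1, Function.update_of_ne h2, hvtwo y hyv hyb hyb']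
    rfl

/-- The comonotone certificate at a configuration whose hubs are isolated (list form). [this file] -/
theorem certificate_at (w : Sym2 (Fin n) → unitInterval) (A : Finset (Fin n))
    (u v a a' b b' c : Fin n) (j : ℕ) (hj : j ≤ 2) (hu : u ∉ A) (hv : v ∉ A) (huv : u ≠ v)
    (ha : a ∈ A) (ha' : a' ∈ A) (hb : b ∈ A) (hb' : b' ∈ A) (hc : c ∈ A)
    (haa' : a ≠ a') (hbb' : b ≠ b') (hab : a ≠ b) (hab' : a ≠ b') (ha'b : a' ≠ b) (ha'b' : a' ≠ b')
    (hca : c ≠ a) (hca' : c ≠ a') (hcb : c ≠ b) (hcb' : c ≠ b') (ω : BondConfig (Fin n))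
    (hisoU : ∀ y : Fin n, y ≠ u → s(u, y) ∉ ω) (hisoV : ∀ y : Fin n, y ≠ v → s(v, y) ∉ ω) :
    0 ≤ (([(((1 - ((w s(u, a) : ℝ) * w s(u, a'))) * (1 - ((w s(v, b) : ℝ) * w s(v, b')))), {ω : BondConfig (Fin n) | (A.filter fun z => ω ∈ openConn c z).card ≤ j}),
      ((-((1 - ((w s(u, a) : ℝ) * w s(u, a'))) * (1 - ((w s(v, b) : ℝ) * w s(v, b'))))), {ω : BondConfig (Fin n) | 1 ≤ (A.filter fun z => ω ∈ openConn u z).card ∧ (A.filter fun z => ω ∈ openConn u z).card ≤ j}),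
      (((1 - ((w s(u, a) : ℝ) * w s(u, a'))) * ((w s(v, b) : ℝ) * w s(v, b'))), (fun ω : BondConfig (Fin n) => insert s(v, b) (insert s(v, b') ω)) ⁻¹' {ω : BondConfig (Fin n) | ω ∉ openConn c u ∧ ω ∉ openConn c v ∧ (A.filter fun z => ω ∈ openConn c z).card ≤ j}),
      ((-((1 - ((w s(u, a) : ℝ) * w s(u, a'))) * ((w s(v, b) : ℝ) * w s(v, b')))), (fun ω : BondConfig (Fin n) => insert s(v, b) (insert s(v, b') ω)) ⁻¹' {ω : BondConfig (Fin n) | ω ∉ openConn c u ∧ ω ∉ openConn c v ∧ 1 ≤ (A.filter fun z => ω ∈ openConn u z ∨ ω ∈ openConn v z).card ∧ (A.filter fun z => ω ∈ openConn u z ∨ ω ∈ openConn v z).card ≤ j}),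
      ((((w s(u, a) : ℝ) * w s(u, a')) * (1 - ((w s(v, b) : ℝ) * w s(v, b')))), (fun ω : BondConfig (Fin n) => insert s(u, a) (insert s(u, a') ω)) ⁻¹' {ω : BondConfig (Fin n) | (A.filter fun z => ω ∈ openConn c z).card ≤ j}),
      ((-(((w s(u, a) : ℝ) * w s(u, a')) * (1 - ((w s(v, b) : ℝ) * w s(v, b'))))), (fun ω : BondConfig (Fin n) => insert s(u, a) (insert s(u, a') ω)) ⁻¹' {ω : BondConfig (Fin n) | 1 ≤ (A.filter fun z => ω ∈ openConn u z).card ∧ (A.filter fun z => ω ∈ openConn u z).card ≤ j}),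
      ((((w s(u, a) : ℝ) * w s(u, a')) * ((w s(v, b) : ℝ) * w s(v, b'))), (fun ω : BondConfig (Fin n) => insert s(u, a) (insert s(u, a') (insert s(v, b) (insert s(v, b') ω)))) ⁻¹' {ω : BondConfig (Fin n) | ω ∉ openConn c u ∧ ω ∉ openConn c v ∧ (A.filter fun z => ω ∈ openConn c z).card ≤ j}),
      ((-(((w s(u, a) : ℝ) * w s(u, a')) * ((w s(v, b) : ℝ) * w s(v, b')))), (fun ω : BondConfig (Fin n) => insert s(u, a) (insert s(u, a') (insert s(v, b) (insert s(v, b') ω)))) ⁻¹' {ω : BondConfig (Fin n) | ω ∉ openConn c u ∧ ω ∉ openConn c v ∧ 1 ≤ (A.filter fun z => ω ∈ openConn u z ∨ ω ∈ openConn v z).card ∧ (A.filter fun z => ω ∈ openConn u z ∨ ω ∈ openConn v z).card ≤ j}),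
      ((-(((w s(u, a) : ℝ) * w s(u, a')) * ((1 - ((w s(u, a) : ℝ) * w s(u, a'))) * (1 - ((w s(v, b) : ℝ) * w s(v, b')))))), {ω : BondConfig (Fin n) | (A.filter fun z => ω ∈ openConn c z).card ≤ j}),
      ((((w s(u, a) : ℝ) * w s(u, a')) * ((1 - ((w s(u, a) : ℝ) * w s(u, a'))) * (1 - ((w s(v, b) : ℝ) * w s(v, b'))))), {ω : BondConfig (Fin n) | (A.filter fun z => ω ∈ openConn a z).card ≤ j}),
      ((-(((w s(u, a) : ℝ) * w s(u, a')) * (((w s(u, a) : ℝ) * w s(u, a')) * (1 - ((w s(v, b) : ℝ) * w s(v, b')))))), (fun ω : BondConfig (Fin n) => insert s(u, a) (insert s(u, a') ω)) ⁻¹' {ω : BondConfig (Fin n) | (A.filter fun z => ω ∈ openConn c z).card ≤ j}),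
      ((((w s(u, a) : ℝ) * w s(u, a')) * (((w s(u, a) : ℝ) * w s(u, a')) * (1 - ((w s(v, b) : ℝ) * w s(v, b'))))), (fun ω : BondConfig (Fin n) => insert s(u, a) (insert s(u, a') ω)) ⁻¹' {ω : BondConfig (Fin n) | (A.filter fun z => ω ∈ openConn a z).card ≤ j}),
      ((-(((w s(u, a) : ℝ) * w s(u, a')) * ((1 - ((w s(u, a) : ℝ) * w s(u, a'))) * ((w s(v, b) : ℝ) * w s(v, b'))))), (fun ω : BondConfig (Fin n) => insert s(v, b) (insert s(v, b') ω)) ⁻¹' {ω : BondConfig (Fin n) | (A.filter fun z => ω ∈ openConn c z).card ≤ j}),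
      ((((w s(u, a) : ℝ) * w s(u, a')) * ((1 - ((w s(u, a) : ℝ) * w s(u, a'))) * ((w s(v, b) : ℝ) * w s(v, b')))), (fun ω : BondConfig (Fin n) => insert s(v, b) (insert s(v, b') ω)) ⁻¹' {ω : BondConfig (Fin n) | (A.filter fun z => ω ∈ openConn a z).card ≤ j}),
      ((-(((w s(u, a) : ℝ) * w s(u, a')) * (((w s(u, a) : ℝ) * w s(u, a')) * ((w s(v, b) : ℝ) * w s(v, b'))))), (fun ω : BondConfig (Fin n) => insert s(u, a) (insert s(u, a') (insert s(v, b) (insert s(v, b') ω)))) ⁻¹' {ω : BondConfig (Fin n) | (A.filter fun z => ω ∈ openConn c z).card ≤ j}),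
      ((((w s(u, a) : ℝ) * w s(u, a')) * (((w s(u, a) : ℝ) * w s(u, a')) * ((w s(v, b) : ℝ) * w s(v, b')))), (fun ω : BondConfig (Fin n) => insert s(u, a) (insert s(u, a') (insert s(v, b) (insert s(v, b') ω)))) ⁻¹' {ω : BondConfig (Fin n) | (A.filter fun z => ω ∈ openConn a z).card ≤ j}),
      ((-(((w s(v, b) : ℝ) * w s(v, b')) * (1 - ((w s(u, a) : ℝ) * w s(u, a'))) * ((1 - ((w s(u, a) : ℝ) * w s(u, a'))) * (1 - ((w s(v, b) : ℝ) * w s(v, b')))))), {ω : BondConfig (Fin n) | (A.filter fun z => ω ∈ openConn c z).card ≤ j}),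
      ((((w s(v, b) : ℝ) * w s(v, b')) * (1 - ((w s(u, a) : ℝ) * w s(u, a'))) * ((1 - ((w s(u, a) : ℝ) * w s(u, a'))) * (1 - ((w s(v, b) : ℝ) * w s(v, b'))))), {ω : BondConfig (Fin n) | (A.filter fun z => ω ∈ openConn b z).card ≤ j}),
      ((-(((w s(v, b) : ℝ) * w s(v, b')) * (1 - ((w s(u, a) : ℝ) * w s(u, a'))) * (((w s(u, a) : ℝ) * w s(u, a')) * (1 - ((w s(v, b) : ℝ) * w s(v, b')))))), (fun ω : BondConfig (Fin n) => insert s(u, a) (insert s(u, a') ω)) ⁻¹' {ω : BondConfig (Fin n) | (A.filter fun z => ω ∈ openConn c z).card ≤ j}),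
      ((((w s(v, b) : ℝ) * w s(v, b')) * (1 - ((w s(u, a) : ℝ) * w s(u, a'))) * (((w s(u, a) : ℝ) * w s(u, a')) * (1 - ((w s(v, b) : ℝ) * w s(v, b'))))), (fun ω : BondConfig (Fin n) => insert s(u, a) (insert s(u, a') ω)) ⁻¹' {ω : BondConfig (Fin n) | (A.filter fun z => ω ∈ openConn b z).card ≤ j}),
      ((-(((w s(v, b) : ℝ) * w s(v, b')) * (1 - ((w s(u, a) : ℝ) * w s(u, a'))) * ((1 - ((w s(u, a) : ℝ) * w s(u, a'))) * ((w s(v, b) : ℝ) * w s(v, b'))))), (fun ω : BondConfig (Fin n) => insert s(v, b) (insert s(v, b') ω)) ⁻¹' {ω : BondConfig (Fin n) | (A.filter fun z => ω ∈ openConn c z).card ≤ j}),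
      ((((w s(v, b) : ℝ) * w s(v, b')) * (1 - ((w s(u, a) : ℝ) * w s(u, a'))) * ((1 - ((w s(u, a) : ℝ) * w s(u, a'))) * ((w s(v, b) : ℝ) * w s(v, b')))), (fun ω : BondConfig (Fin n) => insert s(v, b) (insert s(v, b') ω)) ⁻¹' {ω : BondConfig (Fin n) | (A.filter fun z => ω ∈ openConn b z).card ≤ j}),
      ((-(((w s(v, b) : ℝ) * w s(v, b')) * (1 - ((w s(u, a) : ℝ) * w s(u, a'))) * (((w s(u, a) : ℝ) * w s(u, a')) * ((w s(v, b) : ℝ) * w s(v, b'))))), (fun ω : BondConfig (Fin n) => insert s(u, a) (insert s(u, a') (insert s(v, b) (insert s(v, b') ω)))) ⁻¹' {ω : BondConfig (Fin n) | (A.filter fun z => ω ∈ openConn c z).card ≤ j}),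
      ((((w s(v, b) : ℝ) * w s(v, b')) * (1 - ((w s(u, a) : ℝ) * w s(u, a'))) * (((w s(u, a) : ℝ) * w s(u, a')) * ((w s(v, b) : ℝ) * w s(v, b')))), (fun ω : BondConfig (Fin n) => insert s(u, a) (insert s(u, a') (insert s(v, b) (insert s(v, b') ω)))) ⁻¹' {ω : BondConfig (Fin n) | (A.filter fun z => ω ∈ openConn b z).card ≤ j})] : List (ℝ × Set (BondConfig (Fin n)))).map
      fun ce => ce.1 * ce.2.indicator (1 : BondConfig (Fin n) → ℝ) ω).sum := by
  have ht0 : 0 ≤ ((w s(u, a) : ℝ) * w s(u, a')) := mul_nonneg (w s(u, a)).2.1 (w s(u, a')).2.1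
  have ht1 : ((w s(u, a) : ℝ) * w s(u, a')) ≤ 1 := mul_le_one₀ (w s(u, a)).2.2 (w s(u, a')).2.1 (w s(u, a')).2.2
  have hs0 : 0 ≤ ((w s(v, b) : ℝ) * w s(v, b')) := mul_nonneg (w s(v, b)).2.1 (w s(v, b')).2.1
  have hs1 : ((w s(v, b) : ℝ) * w s(v, b')) ≤ 1 := mul_le_one₀ (w s(v, b)).2.2 (w s(v, b')).2.1 (w s(v, b')).2.2
  obtain ⟨e0c, e0a, e0b, e0L, eUc, eUa, eUb, eUL⟩ :=
    iffs_base_u A ω u v a a' b b' c j hj hu hv huv ha ha' hb hb' hc haa' hab ha'b hca hca' hisoU hisoV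
  obtain ⟨eVc, eVa, eVb, eVr, eVl⟩ :=
    iffs_v A ω u v a a' b b' c j hj hu hv huv ha ha' hb hb' hc hbb' hab hab' hcb hcb' hisoU hisoV
  obtain ⟨eWc, eWa, eWb, eWr, eWl⟩ :=
    iffs_w A ω u v a a' b b' c j hj hu hv huv ha ha' hb hb' hc haa' hbb' hab hab' ha'b ha'b' hca hca' hcb hcb' hisoU hisoV
  have hA2 : (((A.filter fun z => ω ∈ openConn a z) ∪ (A.filter fun z => ω ∈ openConn a' z)).card ≤ j) → ((A.filter fun z => ω ∈ openConn a z).card ≤ j) ∧ ¬ ((openGraph ω).Reachable a b ∨ (openGraph ω).Reachable a b') := fun h =>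
    ⟨le_trans (Finset.card_le_card Finset.subset_union_left) h,
      fun hr => hr.elim (fun h1 => (not_reachable_of_small_pair A ω j hj ha ha' hb haa' hab.symm ha'b.symm h).1 h1.symm)
        (fun h1 => (not_reachable_of_small_pair A ω j hj ha ha' hb' haa' hab'.symm ha'b'.symm h).1 h1.symm)⟩
  have hB2 : (((A.filter fun z => ω ∈ openConn b z) ∪ (A.filter fun z => ω ∈ openConn b' z)).card ≤ j) → ((A.filter fun z => ω ∈ openConn b z).card ≤ j) ∧ ¬ ((openGraph ω).Reachable b a ∨ (openGraph ω).Reachable b a') := fun h =>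
    ⟨le_trans (Finset.card_le_card Finset.subset_union_left) h,
      fun hr => hr.elim (fun h1 => (not_reachable_of_small_pair A ω j hj hb hb' ha hbb' hab hab' h).1 h1.symm)
        (fun h1 => (not_reachable_of_small_pair A ω j hj hb hb' ha' hbb' ha'b ha'b' h).1 h1.symm)⟩
  have key := comonotone_pointwise_abstract ω ((w s(u, a) : ℝ) * w s(u, a')) ((w s(v, b) : ℝ) * w s(v, b')) ht0 ht1 hs0 hs1
    ((openGraph ω).Reachable c a ∨ (openGraph ω).Reachable c a') ((openGraph ω).Reachable c b ∨ (openGraph ω).Reachable c b') ((openGraph ω).Reachable a b ∨ (openGraph ω).Reachable a b') ((openGraph ω).Reachable b a ∨ (openGraph ω).Reachable b a') ((A.filter fun z => ω ∈ openConn c z).card ≤ j) ((A.filter fun z => ω ∈ openConn a z).card ≤ j) ((A.filter fun z => ω ∈ openConn b z).card ≤ j) (((A.filter fun z => ω ∈ openConn a z) ∪ (A.filter fun z => ω ∈ openConn a' z)).card ≤ j) (((A.filter fun z => ω ∈ openConn b z) ∪ (A.filter fun z => ω ∈ openConn b' z)).card ≤ j) hA2 hB2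
    ({ω : BondConfig (Fin n) | (A.filter fun z => ω ∈ openConn c z).card ≤ j}) ({ω : BondConfig (Fin n) | (A.filter fun z => ω ∈ openConn a z).card ≤ j}) ({ω : BondConfig (Fin n) | (A.filter fun z => ω ∈ openConn b z).card ≤ j}) ({ω : BondConfig (Fin n) | 1 ≤ (A.filter fun z => ω ∈ openConn u z).card ∧ (A.filter fun z => ω ∈ openConn u z).card ≤ j}) ((fun ω : BondConfig (Fin n) => insert s(u, a) (insert s(u, a') ω)) ⁻¹' {ω : BondConfig (Fin n) | (A.filter fun z => ω ∈ openConn c z).card ≤ j}) ((fun ω : BondConfig (Fin n) => insert s(u, a) (insert s(u, a') ω)) ⁻¹' {ω : BondConfig (Fin n) | (A.filter fun z => ω ∈ openConn a z).card ≤ j}) ((fun ω : BondConfig (Fin n) => insert s(u, a) (insert s(u, a') ω)) ⁻¹' {ω : BondConfig (Fin n) | (A.filter fun z => ω ∈ openConn b z).card ≤ j}) ((fun ω : BondConfig (Fin n) => insert s(u, a) (insert s(u, a') ω)) ⁻¹' {ω : BondConfig (Fin n) | 1 ≤ (A.filter fun z => ω ∈ openConn u z).card ∧ (A.filter fun z =>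 ω ∈ openConn u z).card ≤ j}) ((fun ω : BondConfig (Fin n) => insert s(v, b) (insert s(v, b') ω)) ⁻¹' {ω : BondConfig (Fin n) | (A.filter fun z => ω ∈ openConn c z).card ≤ j}) ((fun ω : BondConfig (Fin n) => insert s(v, b) (insert s(v, b') ω)) ⁻¹' {ω : BondConfig (Fin n) | (A.filter fun z => ω ∈ openConn a z).card ≤ j}) ((fun ω : BondConfig (Fin n) => insert s(v, b) (insert s(v, b') ω)) ⁻¹' {ω : BondConfig (Fin n) | (A.filter fun z => ω ∈ openConn b z).card ≤ j}) ((fun ω : BondConfig (Fin n) => insert s(v, b) (insert s(v, b') ω)) ⁻¹' {ω : BondConfig (Fin n) | ω ∉ openConn c u ∧ ω ∉ openConn c v ∧ (A.filter fun z => ω ∈ openConn c z).card ≤ j}) ((fun ω : BondConfig (Fin n) => insert s(v, b) (insert s(v, b') ω)) ⁻¹' {ω : BondConfig (Fin n) | ω ∉ openConn c u ∧ ω ∉ openConn c v ∧ 1 ≤ (A.filter fun z => ω ∈ openConn u z ∨ ω ∈ openConn v z).card ∧ (A.filter fun z => ω ∈ openConn u z ∨ ω ∈ openConn v z).card ≤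 j}) ((fun ω : BondConfig (Fin n) => insert s(u, a) (insert s(u, a') (insert s(v, b) (insert s(v, b') ω)))) ⁻¹' {ω : BondConfig (Fin n) | (A.filter fun z => ω ∈ openConn c z).card ≤ j}) ((fun ω : BondConfig (Fin n) => insert s(u, a) (insert s(u, a') (insert s(v, b) (insert s(v, b') ω)))) ⁻¹' {ω : BondConfig (Fin n) | (A.filter fun z => ω ∈ openConn a z).card ≤ j}) ((fun ω : BondConfig (Fin n) => insert s(u, a) (insert s(u, a') (insert s(v, b) (insert s(v, b') ω)))) ⁻¹' {ω : BondConfig (Fin n) | (A.filter fun z => ω ∈ openConn b z).card ≤ j}) ((fun ω : BondConfig (Fin n) => insert s(u, a) (insert s(u, a') (insert s(v, b) (insert s(v, b') ω)))) ⁻¹' {ω : BondConfig (Fin n) | ω ∉ openConn c u ∧ ω ∉ openConn c v ∧ (A.filter fun z => ω ∈ openConn c z).card ≤ j}) ((fun ω : BondConfig (Fin n) => insert s(u, a) (insert s(u, a') (insert s(v, b) (insert s(v, b') ω)))) ⁻¹' {ω : BondConfig (Fin n) | ω ∉ openConn c u ∧ ω ∉ openConn c v ∧ 1 ≤ (A.filter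 fun z => ω ∈ openConn u z ∨ ω ∈ openConn v z).card ∧ (A.filter fun z => ω ∈ openConn u z ∨ ω ∈ openConn v z).card ≤ j})
    e0c e0a e0b e0L eUc eUa eUb eUL eVc eVa eVb eVr eVl eWc eWa eWb eWr eWl
  simp only [List.map_cons, List.map_nil, List.sum_cons, List.sum_nil]
  linarith

/-- The comonotone certificate holds almost surely under the base measure (list form). [this file] -/
theorem certificate_ae (w : Sym2 (Fin n) → unitInterval) (A : Finset (Fin n))
    (u v a a' b b' c : Fin n) (j : ℕ) (hj : j ≤ 2) (hu : u ∉ A) (hv : v ∉ A) (huv : u ≠ v)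
    (ha : a ∈ A) (ha' : a' ∈ A) (hb : b ∈ A) (hb' : b' ∈ A) (hc : c ∈ A)
    (haa' : a ≠ a') (hbb' : b ≠ b') (hab : a ≠ b) (hab' : a ≠ b') (ha'b : a' ≠ b) (ha'b' : a' ≠ b')
    (hca : c ≠ a) (hca' : c ≠ a') (hcb : c ≠ b) (hcb' : c ≠ b')
    (hutwo : ∀ y : Fin n, y ≠ u → y ≠ a → y ≠ a' → w s(u, y) = 0)
    (hvtwo : ∀ y : Fin n, y ≠ v → y ≠ b → y ≠ b' → w s(v, y) = 0) :
    ∀ᵐ ω ∂(prodBernoulli (Function.update (Function.update (Function.update (Function.update w s(v, b) 0) s(v, b') 0) s(u, a) 0) s(u, a') 0)),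
      0 ≤ (([(((1 - ((w s(u, a) : ℝ) * w s(u, a'))) * (1 - ((w s(v, b) : ℝ) * w s(v, b')))), {ω : BondConfig (Fin n) | (A.filter fun z => ω ∈ openConn c z).card ≤ j}),
      ((-((1 - ((w s(u, a) : ℝ) * w s(u, a'))) * (1 - ((w s(v, b) : ℝ) * w s(v, b'))))), {ω : BondConfig (Fin n) | 1 ≤ (A.filter fun z => ω ∈ openConn u z).card ∧ (A.filter fun z => ω ∈ openConn u z).card ≤ j}),
      (((1 - ((w s(u, a) : ℝ) * w s(u, a'))) * ((w s(v, b) : ℝ) * w s(v, b'))), (fun ω : BondConfig (Fin n) => insert s(v, b) (insert s(v, b') ω)) ⁻¹' {ω : BondConfig (Fin n) | ω ∉ openConn c u ∧ ω ∉ openConn c v ∧ (A.filter fun z => ω ∈ openConn c z).card ≤ j}),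
      ((-((1 - ((w s(u, a) : ℝ) * w s(u, a'))) * ((w s(v, b) : ℝ) * w s(v, b')))), (fun ω : BondConfig (Fin n) => insert s(v, b) (insert s(v, b') ω)) ⁻¹' {ω : BondConfig (Fin n) | ω ∉ openConn c u ∧ ω ∉ openConn c v ∧ 1 ≤ (A.filter fun z => ω ∈ openConn u z ∨ ω ∈ openConn v z).card ∧ (A.filter fun z => ω ∈ openConn u z ∨ ω ∈ openConn v z).card ≤ j}),
      ((((w s(u, a) : ℝ) * w s(u, a')) * (1 - ((w s(v, b) : ℝ) * w s(v, b')))), (fun ω : BondConfig (Fin n) => insert s(u, a) (insert s(u, a') ω)) ⁻¹' {ω : BondConfig (Fin n) | (A.filter fun z => ω ∈ openConn c z).card ≤ j}),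
      ((-(((w s(u, a) : ℝ) * w s(u, a')) * (1 - ((w s(v, b) : ℝ) * w s(v, b'))))), (fun ω : BondConfig (Fin n) => insert s(u, a) (insert s(u, a') ω)) ⁻¹' {ω : BondConfig (Fin n) | 1 ≤ (A.filter fun z => ω ∈ openConn u z).card ∧ (A.filter fun z => ω ∈ openConn u z).card ≤ j}),
      ((((w s(u, a) : ℝ) * w s(u, a')) * ((w s(v, b) : ℝ) * w s(v, b'))), (fun ω : BondConfig (Fin n) => insert s(u, a) (insert s(u, a') (insert s(v, b) (insert s(v, b') ω)))) ⁻¹' {ω : BondConfig (Fin n) | ω ∉ openConn c u ∧ ω ∉ openConn c v ∧ (A.filter fun z => ω ∈ openConn c z).card ≤ j}),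
      ((-(((w s(u, a) : ℝ) * w s(u, a')) * ((w s(v, b) : ℝ) * w s(v, b')))), (fun ω : BondConfig (Fin n) => insert s(u, a) (insert s(u, a') (insert s(v, b) (insert s(v, b') ω)))) ⁻¹' {ω : BondConfig (Fin n) | ω ∉ openConn c u ∧ ω ∉ openConn c v ∧ 1 ≤ (A.filter fun z => ω ∈ openConn u z ∨ ω ∈ openConn v z).card ∧ (A.filter fun z => ω ∈ openConn u z ∨ ω ∈ openConn v z).card ≤ j}),
      ((-(((w s(u, a) : ℝ) * w s(u, a')) * ((1 - ((w s(u, a) : ℝ) * w s(u, a'))) * (1 - ((w s(v, b) : ℝ) * w s(v, b')))))), {ω : BondConfig (Fin n) | (A.filter fun z => ω ∈ openConn c z).card ≤ j}),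
      ((((w s(u, a) : ℝ) * w s(u, a')) * ((1 - ((w s(u, a) : ℝ) * w s(u, a'))) * (1 - ((w s(v, b) : ℝ) * w s(v, b'))))), {ω : BondConfig (Fin n) | (A.filter fun z => ω ∈ openConn a z).card ≤ j}),
      ((-(((w s(u, a) : ℝ) * w s(u, a')) * (((w s(u, a) : ℝ) * w s(u, a')) * (1 - ((w s(v, b) : ℝ) * w s(v, b')))))), (fun ω : BondConfig (Fin n) => insert s(u, a) (insert s(u, a') ω)) ⁻¹' {ω : BondConfig (Fin n) | (A.filter fun z => ω ∈ openConn c z).card ≤ j}),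
      ((((w s(u, a) : ℝ) * w s(u, a')) * (((w s(u, a) : ℝ) * w s(u, a')) * (1 - ((w s(v, b) : ℝ) * w s(v, b'))))), (fun ω : BondConfig (Fin n) => insert s(u, a) (insert s(u, a') ω)) ⁻¹' {ω : BondConfig (Fin n) | (A.filter fun z => ω ∈ openConn a z).card ≤ j}),
      ((-(((w s(u, a) : ℝ) * w s(u, a')) * ((1 - ((w s(u, a) : ℝ) * w s(u, a'))) * ((w s(v, b) : ℝ) * w s(v, b'))))), (fun ω : BondConfig (Fin n) => insert s(v, b) (insert s(v, b') ω)) ⁻¹' {ω : BondConfig (Fin n) | (A.filter fun z => ω ∈ openConn c z).card ≤ j}),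
      ((((w s(u, a) : ℝ) * w s(u, a')) * ((1 - ((w s(u, a) : ℝ) * w s(u, a'))) * ((w s(v, b) : ℝ) * w s(v, b')))), (fun ω : BondConfig (Fin n) => insert s(v, b) (insert s(v, b') ω)) ⁻¹' {ω : BondConfig (Fin n) | (A.filter fun z => ω ∈ openConn a z).card ≤ j}),
      ((-(((w s(u, a) : ℝ) * w s(u, a')) * (((w s(u, a) : ℝ) * w s(u, a')) * ((w s(v, b) : ℝ) * w s(v, b'))))), (fun ω : BondConfig (Fin n) => insert s(u, a) (insert s(u, a') (insert s(v, b) (insert s(v, b') ω)))) ⁻¹' {ω : BondConfig (Fin n) | (A.filter fun z => ω ∈ openConn c z).card ≤ j}),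
      ((((w s(u, a) : ℝ) * w s(u, a')) * (((w s(u, a) : ℝ) * w s(u, a')) * ((w s(v, b) : ℝ) * w s(v, b')))), (fun ω : BondConfig (Fin n) => insert s(u, a) (insert s(u, a') (insert s(v, b) (insert s(v, b') ω)))) ⁻¹' {ω : BondConfig (Fin n) | (A.filter fun z => ω ∈ openConn a z).card ≤ j}),
      ((-(((w s(v, b) : ℝ) * w s(v, b')) * (1 - ((w s(u, a) : ℝ) * w s(u, a'))) * ((1 - ((w s(u, a) : ℝ) * w s(u, a'))) * (1 - ((w s(v, b) : ℝ) * w s(v, b')))))), {ω : BondConfig (Fin n) | (A.filter fun z => ω ∈ openConn c z).card ≤ j}),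
      ((((w s(v, b) : ℝ) * w s(v, b')) * (1 - ((w s(u, a) : ℝ) * w s(u, a'))) * ((1 - ((w s(u, a) : ℝ) * w s(u, a'))) * (1 - ((w s(v, b) : ℝ) * w s(v, b'))))), {ω : BondConfig (Fin n) | (A.filter fun z => ω ∈ openConn b z).card ≤ j}),
      ((-(((w s(v, b) : ℝ) * w s(v, b')) * (1 - ((w s(u, a) : ℝ) * w s(u, a'))) * (((w s(u, a) : ℝ) * w s(u, a')) * (1 - ((w s(v, b) : ℝ) * w s(v, b')))))), (fun ω : BondConfig (Fin n) => insert s(u, a) (insert s(u, a') ω)) ⁻¹' {ω : BondConfig (Fin n) | (A.filter fun z => ω ∈ openConn c z).card ≤ j}),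
      ((((w s(v, b) : ℝ) * w s(v, b')) * (1 - ((w s(u, a) : ℝ) * w s(u, a'))) * (((w s(u, a) : ℝ) * w s(u, a')) * (1 - ((w s(v, b) : ℝ) * w s(v, b'))))), (fun ω : BondConfig (Fin n) => insert s(u, a) (insert s(u, a') ω)) ⁻¹' {ω : BondConfig (Fin n) | (A.filter fun z => ω ∈ openConn b z).card ≤ j}),
      ((-(((w s(v, b) : ℝ) * w s(v, b')) * (1 - ((w s(u, a) : ℝ) * w s(u, a'))) * ((1 - ((w s(u, a) : ℝ) * w s(u, a'))) * ((w s(v, b) : ℝ) * w s(v, b'))))), (fun ω : BondConfig (Fin n) => insert s(v, b) (insert s(v, b') ω)) ⁻¹' {ω : BondConfig (Fin n) | (A.filter fun z => ω ∈ openConn c z).card ≤ j}),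
      ((((w s(v, b) : ℝ) * w s(v, b')) * (1 - ((w s(u, a) : ℝ) * w s(u, a'))) * ((1 - ((w s(u, a) : ℝ) * w s(u, a'))) * ((w s(v, b) : ℝ) * w s(v, b')))), (fun ω : BondConfig (Fin n) => insert s(v, b) (insert s(v, b') ω)) ⁻¹' {ω : BondConfig (Fin n) | (A.filter fun z => ω ∈ openConn b z).card ≤ j}),
      ((-(((w s(v, b) : ℝ) * w s(v, b')) * (1 - ((w s(u, a) : ℝ) * w s(u, a'))) * (((w s(u, a) : ℝ) * w s(u, a')) * ((w s(v, b) : ℝ) * w s(v, b'))))), (fun ω : BondConfig (Fin n) => insert s(u, a) (insert s(u, a') (insert s(v, b) (insert s(v, b') ω)))) ⁻¹' {ω : BondConfig (Fin n) | (A.filter fun z => ω ∈ openConn c z).card ≤ j}),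
      ((((w s(v, b) : ℝ) * w s(v, b')) * (1 - ((w s(u, a) : ℝ) * w s(u, a'))) * (((w s(u, a) : ℝ) * w s(u, a')) * ((w s(v, b) : ℝ) * w s(v, b')))), (fun ω : BondConfig (Fin n) => insert s(u, a) (insert s(u, a') (insert s(v, b) (insert s(v, b') ω)))) ⁻¹' {ω : BondConfig (Fin n) | (A.filter fun z => ω ∈ openConn b z).card ≤ j})] : List (ℝ × Set (BondConfig (Fin n)))).map
      fun ce => ce.1 * ce.2.indicator (1 : BondConfig (Fin n) → ℝ) ω).sum := by
  have hN := prodBernoulli_setOf_exists_mem_eq_zero (Function.update (Function.update (Function.update (Function.update w s(v, b) 0) s(v, b') 0) s(u, a) 0) s(u, a') 0) _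
    (hubPairs_weight_zero w A u v a a' b b' hu hv huv ha ha' hb hb' haa' hbb' hutwo hvtwo)
  rw [ae_iff]
  refine measure_mono_null (fun ω hω => ?_) hN
  simp only [Set.mem_setOf_eq] at hω ⊢
  by_contra hnot
  apply hω
  have hisoU : ∀ y : Fin n, y ≠ u → s(u, y) ∉ ω := fun y hy h =>
    hnot ⟨s(u, y), Finset.mem_union_left _ (Finset.mem_image.2 ⟨y, Finset.mem_filter.2 ⟨Finset.mem_univ _, hy⟩, rfl⟩), h⟩
  have hisoV : ∀ y : Fin n, y ≠ v → s(v, y) ∉ ω := fun y hy h =>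
    hnot ⟨s(v, y), Finset.mem_union_right _ (Finset.mem_image.2 ⟨y, Finset.mem_filter.2 ⟨Finset.mem_univ _, hy⟩, rfl⟩), h⟩
  exact certificate_at w A u v a a' b b' c j hj hu hv huv ha ha' hb hb' hc haa' hbb' hab hab' ha'b ha'b' hca hca' hcb hcb' ω hisoU hisoV

/-- **The comonotone certificate integrated (P2 at level `j ≤ 2`).**  For two two-port stars `u = {a, a'}`,
`v = {b, b'}` (hubs `u, v ∉ A` carrying no other open pair, ports in `A` pairwise distinct, `c ∈ A` off the ports) and
`j ≤ 2`: if `P_w(R_a) ≤ P_w(R_c)` and `P_w(R_b) ≤ P_w(R_c)` (`R_x = {x lonely}`), then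
`0 ≤ (1 − θ_u)·h_∅ + θ_u·h_{aa'}` — the hypothesis `hE00` of `championStabilityPair_twoStars_of_comonotone`.
[this file; memo TWO-PORT-PEELING.md §5] -/
theorem comonotone_nonneg_levelTwo (w : Sym2 (Fin n) → unitInterval) (A : Finset (Fin n))
    (u v a a' b b' c : Fin n) (j : ℕ) (hj : j ≤ 2) (hu : u ∉ A) (hv : v ∉ A) (huv : u ≠ v)
    (ha : a ∈ A) (ha' : a' ∈ A) (hb : b ∈ A) (hb' : b' ∈ A) (hc : c ∈ A)
    (haa' : a ≠ a') (hbb' : b ≠ b') (hab : a ≠ b) (hab' : a ≠ b') (ha'b : a' ≠ b) (ha'b' : a' ≠ b')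
    (hca : c ≠ a) (hca' : c ≠ a') (hcb : c ≠ b) (hcb' : c ≠ b')
    (hutwo : ∀ y : Fin n, y ≠ u → y ≠ a → y ≠ a' → w s(u, y) = 0)
    (hvtwo : ∀ y : Fin n, y ≠ v → y ≠ b → y ≠ b' → w s(v, y) = 0)
    (hKa : (prodBernoulli w).real {ω : BondConfig (Fin n) | (A.filter fun z => ω ∈ openConn a z).card ≤ j} ≤ (prodBernoulli w).real {ω : BondConfig (Fin n) | (A.filter fun z => ω ∈ openConn c z).card ≤ j})
    (hKb : (prodBernoulli w).real {ω : BondConfig (Fin n) | (A.filter fun z => ω ∈ openConn b z).card ≤ j} ≤ (prodBernoulli w).real {ω : BondConfig (Fin n) | (A.filter fun z => ω ∈ openConn c z).card ≤ j}) :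
    0 ≤ (1 - ((w s(u, a) : ℝ) * w s(u, a'))) * ((1 - ((w s(v, b) : ℝ) * w s(v, b'))) * ((prodBernoulli (Function.update (Function.update (Function.update (Function.update w s(v, b) 0) s(v, b') 0) s(u, a) 0) s(u, a') 0)).real {ω : BondConfig (Fin n) | (A.filter fun z => ω ∈ openConn c z).card ≤ j} - (prodBernoulli (Function.update (Function.update (Function.update (Function.update w s(v, b) 0) s(v, b') 0) s(u, a) 0) s(u, a') 0)).real {ω : BondConfig (Fin n) | 1 ≤ (A.filter fun z => ω ∈ openConn u z).card ∧ (A.filter fun z => ω ∈ openConn u z).card ≤ j}) + ((w s(v, b) : ℝ) * w s(v, b')) * ((prodBernoulli (Function.update (Function.update (Function.update (Function.update w s(v, b) 1) s(v, b') 1) s(u, a) 0) s(u, a') 0)).real {ω : BondConfig (Fin n) | ω ∉ openConn c u ∧ ω ∉ openConn c v ∧ (A.filter fun z => ω ∈ openConn c z).card ≤ j} - (prodBernoulli (Function.update (Function.update (Function.update (Function.update w s(v, b) 1) s(v, b') 1) s(u, a) 0) s(u, a') 0)).real {ω : BondConfig (Fin n) | ω ∉ openConn c u ∧ ω ∉ openConn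 c v ∧ 1 ≤ (A.filter fun z => ω ∈ openConn u z ∨ ω ∈ openConn v z).card ∧ (A.filter fun z => ω ∈ openConn u z ∨ ω ∈ openConn v z).card ≤ j})) +
      ((w s(u, a) : ℝ) * w s(u, a')) * ((1 - ((w s(v, b) : ℝ) * w s(v, b'))) * ((prodBernoulli (Function.update (Function.update (Function.update (Function.update w s(v, b) 0) s(v, b') 0) s(u, a) 1) s(u, a') 1)).real {ω : BondConfig (Fin n) | (A.filter fun z => ω ∈ openConn c z).card ≤ j} - (prodBernoulli (Function.update (Function.update (Function.update (Function.update w s(v, b) 0) s(v, b') 0) s(u, a) 1) s(u, a') 1)).real {ω : BondConfig (Fin n) | 1 ≤ (A.filter fun z => ω ∈ openConn u z).card ∧ (A.filter fun z => ω ∈ openConn u z).card ≤ j}) + ((w s(v, b) : ℝ) * w s(v, b')) * ((prodBernoulli (Function.update (Function.update (Function.update (Function.update w s(v, b) 1) s(v, b') 1) s(u, a) 1) s(u, a') 1)).real {ω : BondConfig (Fin n) | ω ∉ openConn c u ∧ ω ∉ openConn c v ∧ (A.filter fun z => ω ∈ openConn c z).card ≤ j} - (prodBernoulli (Function.update (Function.update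 (Function.update (Function.update w s(v, b) 1) s(v, b') 1) s(u, a) 1) s(u, a') 1)).real {ω : BondConfig (Fin n) | ω ∉ openConn c u ∧ ω ∉ openConn c v ∧ 1 ≤ (A.filter fun z => ω ∈ openConn u z ∨ ω ∈ openConn v z).card ∧ (A.filter fun z => ω ∈ openConn u z ∨ ω ∈ openConn v z).card ≤ j})) := by
  have hua : u ≠ a := fun h => hu (h ▸ ha)
  have hua' : u ≠ a' := fun h => hu (h ▸ ha')
  have hub : u ≠ b := fun h => hu (h ▸ hb)
  have hub' : u ≠ b' := fun h => hu (h ▸ hb')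
  have huc : u ≠ c := fun h => hu (h ▸ hc)
  have hva : v ≠ a := fun h => hv (h ▸ ha)
  have hvb : v ≠ b := fun h => hv (h ▸ hb)
  have hvb' : v ≠ b' := fun h => hv (h ▸ hb')
  have hvc : v ≠ c := fun h => hv (h ▸ hc)
  have png : ∀ {p q r t : Fin n}, (p ≠ r ∨ q ≠ t) → (p ≠ t ∨ q ≠ r) → (s(p, q) : Sym2 (Fin n)) ≠ s(r, t) := by
    intro p q r t h1 h2 h
    rw [Sym2.eq_iff] at h
    rcases h with ⟨h3, h4⟩ | ⟨h3, h4⟩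
    · rcases h1 with h1 | h1
      · exact h1 h3
      · exact h1 h4
    · rcases h2 with h2 | h2
      · exact h2 h3
      · exact h2 h4
  have nUA : (s(u, a) : Sym2 (Fin n)) ≠ s(u, a') := png (Or.inr haa') (Or.inl hua')
  have nVB : (s(v, b) : Sym2 (Fin n)) ≠ s(v, b') := png (Or.inr hbb') (Or.inl hvb')
  have nAB : (s(u, a) : Sym2 (Fin n)) ≠ s(v, b) := png (Or.inl huv) (Or.inl hub)
  have nAB' : (s(u, a) : Sym2 (Fin n)) ≠ s(v, b') := png (Or.inl huv) (Or.inl hub')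
  have nA'B : (s(u, a') : Sym2 (Fin n)) ≠ s(v, b) := png (Or.inl huv) (Or.inl hub)
  have nA'B' : (s(u, a') : Sym2 (Fin n)) ≠ s(v, b') := png (Or.inl huv) (Or.inl hub')
  have nUyB : ∀ y : Fin n, (s(u, y) : Sym2 (Fin n)) ≠ s(v, b) := fun y => png (Or.inl huv) (Or.inl hub)
  have nUyB' : ∀ y : Fin n, (s(u, y) : Sym2 (Fin n)) ≠ s(v, b') := fun y => png (Or.inl huv) (Or.inl hub')
  have ht0 : 0 ≤ ((w s(u, a) : ℝ) * w s(u, a')) := mul_nonneg (w s(u, a)).2.1 (w s(u, a')).2.1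
  have ht1 : ((w s(u, a) : ℝ) * w s(u, a')) ≤ 1 := mul_le_one₀ (w s(u, a)).2.2 (w s(u, a')).2.1 (w s(u, a')).2.2
  have hs0 : 0 ≤ ((w s(v, b) : ℝ) * w s(v, b')) := mul_nonneg (w s(v, b)).2.1 (w s(v, b')).2.1
  have hs1 : ((w s(v, b) : ℝ) * w s(v, b')) ≤ 1 := mul_le_one₀ (w s(v, b)).2.2 (w s(v, b')).2.1 (w s(v, b')).2.2
  have hutwo0 : ∀ y : Fin n, y ≠ u → y ≠ a → y ≠ a' →
      Function.update (Function.update w s(v, b) 0) s(v, b') 0 s(u, y) = 0 := by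
    intro y hy hya hya'
    rw [Function.update_of_ne (nUyB' y), Function.update_of_ne (nUyB y)]
    exact hutwo y hy hya hya'
  have hutwo1 : ∀ y : Fin n, y ≠ u → y ≠ a → y ≠ a' →
      Function.update (Function.update w s(v, b) 1) s(v, b') 1 s(u, y) = 0 := by
    intro y hy hya hya'
    rw [Function.update_of_ne (nUyB' y), Function.update_of_ne (nUyB y)]
    exact hutwo y hy hya hya'
  have hwa0 : Function.update (Function.update w s(v, b) 0) s(v, b') 0 s(u, a) = w s(u, a) := by
    rw [Function.update_of_ne nAB', Function.update_of_ne nAB]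
  have hwa'0 : Function.update (Function.update w s(v, b) 0) s(v, b') 0 s(u, a') = w s(u, a') := by
    rw [Function.update_of_ne nA'B', Function.update_of_ne nA'B]
  have hwa1 : Function.update (Function.update w s(v, b) 1) s(v, b') 1 s(u, a) = w s(u, a) := by
    rw [Function.update_of_ne nAB', Function.update_of_ne nAB]
  have hwa'1 : Function.update (Function.update w s(v, b) 1) s(v, b') 1 s(u, a') = w s(u, a') := by
    rw [Function.update_of_ne nA'B', Function.update_of_ne nA'B]
  have e1c := relay_law_eq w A c j hv hbb' hvb.symm hvb'.symm hvc.symm hvtwo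
  have e2c := relay_law_eq (Function.update (Function.update w s(v, b) 0) s(v, b') 0) A c j hu haa' hua.symm hua'.symm huc.symm hutwo0
  have e3c := relay_law_eq (Function.update (Function.update w s(v, b) 1) s(v, b') 1) A c j hu haa' hua.symm hua'.symm huc.symm hutwo1
  rw [hwa0, hwa'0] at e2c
  rw [hwa1, hwa'1] at e3c
  rw [e2c, e3c] at e1c
  have e1a := relay_law_eq w A a j hv hbb' hvb.symm hvb'.symm hva.symm hvtwo
  have e2a := relay_law_eq (Function.update (Function.update w s(v, b) 0) s(v, b') 0) A a j hu haa' hua.symm hua'.symm hua.symm hutwo0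
  have e3a := relay_law_eq (Function.update (Function.update w s(v, b) 1) s(v, b') 1) A a j hu haa' hua.symm hua'.symm hua.symm hutwo1
  rw [hwa0, hwa'0] at e2a
  rw [hwa1, hwa'1] at e3a
  rw [e2a, e3a] at e1a
  have e1b := relay_law_eq w A b j hv hbb' hvb.symm hvb'.symm hvb.symm hvtwo
  have e2b := relay_law_eq (Function.update (Function.update w s(v, b) 0) s(v, b') 0) A b j hu haa' hua.symm hua'.symm hub.symm hutwo0
  have e3b := relay_law_eq (Function.update (Function.update w s(v, b) 1) s(v, b') 1) A b j hu haa' hua.symm hua'.symm hub.symm hutwo1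
  rw [hwa0, hwa'0] at e2b
  rw [hwa1, hwa'1] at e3b
  rw [e2b, e3b] at e1b
  have PU : ∀ S : Set (BondConfig (Fin n)), (prodBernoulli (Function.update (Function.update (Function.update (Function.update w s(v, b) 0) s(v, b') 0) s(u, a) 1) s(u, a') 1)).real S =
      (prodBernoulli (Function.update (Function.update (Function.update (Function.update w s(v, b) 0) s(v, b') 0) s(u, a) 0) s(u, a') 0)).real ((fun ω : BondConfig (Fin n) => insert s(u, a) (insert s(u, a') ω)) ⁻¹' S) := fun S =>
    real_update_two_pull (Function.update (Function.update w s(v, b) 0) s(v, b') 0) nUA S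
  have PV : ∀ S : Set (BondConfig (Fin n)), (prodBernoulli (Function.update (Function.update (Function.update (Function.update w s(v, b) 1) s(v, b') 1) s(u, a) 0) s(u, a') 0)).real S =
      (prodBernoulli (Function.update (Function.update (Function.update (Function.update w s(v, b) 0) s(v, b') 0) s(u, a) 0) s(u, a') 0)).real ((fun ω : BondConfig (Fin n) => insert s(v, b) (insert s(v, b') ω)) ⁻¹' S) := fun S => by
    rw [update_comm4 w nAB.symm nA'B.symm nAB'.symm nA'B'.symm 1 1 0 0,
      real_update_two_pull (Function.update (Function.update w s(u, a) 0) s(u, a') 0) nVB S,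
      update_comm4 w nAB nAB' nA'B nA'B' 0 0 0 0]
  have PW : ∀ S : Set (BondConfig (Fin n)), (prodBernoulli (Function.update (Function.update (Function.update (Function.update w s(v, b) 1) s(v, b') 1) s(u, a) 1) s(u, a') 1)).real S =
      (prodBernoulli (Function.update (Function.update (Function.update (Function.update w s(v, b) 0) s(v, b') 0) s(u, a) 0) s(u, a') 0)).real ((fun ω : BondConfig (Fin n) => insert s(u, a) (insert s(u, a') (insert s(v, b) (insert s(v, b') ω)))) ⁻¹' S) := fun S => by
    rw [real_update_two_pull (Function.update (Function.update w s(v, b) 1) s(v, b') 1) nUA S, PV]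
    rfl
  have hKa' : 0 ≤ (((1 - ((w s(u, a) : ℝ) * w s(u, a'))) * (1 - ((w s(v, b) : ℝ) * w s(v, b')))) * (prodBernoulli (Function.update (Function.update (Function.update (Function.update w s(v, b) 0) s(v, b') 0) s(u, a) 0) s(u, a') 0)).real {ω : BondConfig (Fin n) | (A.filter fun z => ω ∈ openConn c z).card ≤ j} + (((w s(u, a) : ℝ) * w s(u, a')) * (1 - ((w s(v, b) : ℝ) * w s(v, b')))) * (prodBernoulli (Function.update (Function.update (Function.update (Function.update w s(v, b) 0) s(v, b') 0) s(u, a) 0) s(u, a') 0)).real ((fun ω : BondConfig (Fin n) => insert s(u, a) (insert s(u, a') ω)) ⁻¹' {ω : BondConfig (Fin n) | (A.filter fun z => ω ∈ openConn c z).card ≤ j}) + ((1 - ((w s(u, a) : ℝ) * w s(u, a'))) * ((w s(v, b) : ℝ) * w s(v, b'))) * (prodBernoulli (Function.update (Function.update (Function.update (Function.update w s(v, b) 0) s(v, b') 0) s(u, a) 0) s(u, a') 0)).real ((fun ω : BondConfig (Fin n) => insert s(v, b) (insert s(v, b') ω)) ⁻¹' {ω : BondConfig (Fin n) | (A.filter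 fun z => ω ∈ openConn c z).card ≤ j}) + (((w s(u, a) : ℝ) * w s(u, a')) * ((w s(v, b) : ℝ) * w s(v, b'))) * (prodBernoulli (Function.update (Function.update (Function.update (Function.update w s(v, b) 0) s(v, b') 0) s(u, a) 0) s(u, a') 0)).real ((fun ω : BondConfig (Fin n) => insert s(u, a) (insert s(u, a') (insert s(v, b) (insert s(v, b') ω)))) ⁻¹' {ω : BondConfig (Fin n) | (A.filter fun z => ω ∈ openConn c z).card ≤ j})) -
      (((1 - ((w s(u, a) : ℝ) * w s(u, a'))) * (1 - ((w s(v, b) : ℝ) * w s(v, b')))) * (prodBernoulli (Function.update (Function.update (Function.update (Function.update w s(v, b) 0) s(v, b') 0) s(u, a) 0) s(u, a') 0)).real {ω : BondConfig (Fin n) | (A.filter fun z => ω ∈ openConn a z).card ≤ j} + (((w s(u, a) : ℝ) * w s(u, a')) * (1 - ((w s(v, b) : ℝ) * w s(v, b')))) * (prodBernoulli (Function.update (Function.update (Function.update (Function.update w s(v, b) 0) s(v, b') 0) s(u, a) 0) s(u, a') 0)).real ((fun ω : BondConfig (Fin n) => insert s(u, a) (insert s(u, a') ω)) ⁻¹'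 {ω : BondConfig (Fin n) | (A.filter fun z => ω ∈ openConn a z).card ≤ j}) + ((1 - ((w s(u, a) : ℝ) * w s(u, a'))) * ((w s(v, b) : ℝ) * w s(v, b'))) * (prodBernoulli (Function.update (Function.update (Function.update (Function.update w s(v, b) 0) s(v, b') 0) s(u, a) 0) s(u, a') 0)).real ((fun ω : BondConfig (Fin n) => insert s(v, b) (insert s(v, b') ω)) ⁻¹' {ω : BondConfig (Fin n) | (A.filter fun z => ω ∈ openConn a z).card ≤ j}) + (((w s(u, a) : ℝ) * w s(u, a')) * ((w s(v, b) : ℝ) * w s(v, b'))) * (prodBernoulli (Function.update (Function.update (Function.update (Function.update w s(v, b) 0) s(v, b') 0) s(u, a) 0) s(u, a') 0)).real ((fun ω : BondConfig (Fin n) => insert s(u, a) (insert s(u, a') (insert s(v, b) (insert s(v, b') ω)))) ⁻¹' {ω : BondConfig (Fin n) | (A.filter fun z => ω ∈ openConn a z).card ≤ j})) := by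
    have h := sub_nonneg.2 hKa
    rw [e1c, e1a, PU, PU, PV, PV, PW, PW] at h
    linarith
  have hKb' : 0 ≤ (((1 - ((w s(u, a) : ℝ) * w s(u, a'))) * (1 - ((w s(v, b) : ℝ) * w s(v, b')))) * (prodBernoulli (Function.update (Function.update (Function.update (Function.update w s(v, b) 0) s(v, b') 0) s(u, a) 0) s(u, a') 0)).real {ω : BondConfig (Fin n) | (A.filter fun z => ω ∈ openConn c z).card ≤ j} + (((w s(u, a) : ℝ) * w s(u, a')) * (1 - ((w s(v, b) : ℝ) * w s(v, b')))) * (prodBernoulli (Function.update (Function.update (Function.update (Function.update w s(v, b) 0) s(v, b') 0) s(u, a) 0) s(u, a') 0)).real ((fun ω : BondConfig (Fin n) => insert s(u, a) (insert s(u, a') ω)) ⁻¹' {ω : BondConfig (Fin n) | (A.filter fun z => ω ∈ openConn c z).card ≤ j}) + ((1 - ((w s(u, a) : ℝ) * w s(u, a'))) * ((w s(v, b) : ℝ) * w s(v, b'))) * (prodBernoulli (Function.update (Function.update (Function.update (Function.update w s(v, b) 0) s(v, b') 0) s(u, a) 0) s(u, a') 0)).real ((fun ω : BondConfig (Fin n)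 => insert s(v, b) (insert s(v, b') ω)) ⁻¹' {ω : BondConfig (Fin n) | (A.filter fun z => ω ∈ openConn c z).card ≤ j}) + (((w s(u, a) : ℝ) * w s(u, a')) * ((w s(v, b) : ℝ) * w s(v, b'))) * (prodBernoulli (Function.update (Function.update (Function.update (Function.update w s(v, b) 0) s(v, b') 0) s(u, a) 0) s(u, a') 0)).real ((fun ω : BondConfig (Fin n) => insert s(u, a) (insert s(u, a') (insert s(v, b) (insert s(v, b') ω)))) ⁻¹' {ω : BondConfig (Fin n) | (A.filter fun z => ω ∈ openConn c z).card ≤ j})) -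
      (((1 - ((w s(u, a) : ℝ) * w s(u, a'))) * (1 - ((w s(v, b) : ℝ) * w s(v, b')))) * (prodBernoulli (Function.update (Function.update (Function.update (Function.update w s(v, b) 0) s(v, b') 0) s(u, a) 0) s(u, a') 0)).real {ω : BondConfig (Fin n) | (A.filter fun z => ω ∈ openConn b z).card ≤ j} + (((w s(u, a) : ℝ) * w s(u, a')) * (1 - ((w s(v, b) : ℝ) * w s(v, b')))) * (prodBernoulli (Function.update (Function.update (Function.update (Function.update w s(v, b) 0) s(v, b') 0) s(u, a) 0) s(u, a') 0)).real ((fun ω : BondConfig (Fin n) => insert s(u, a) (insert s(u, a') ω)) ⁻¹' {ω : BondConfig (Fin n) | (A.filter fun z => ω ∈ openConn b z).card ≤ j}) + ((1 - ((w s(u, a) : ℝ) * w s(u, a'))) * ((w s(v, b) : ℝ) * w s(v, b'))) * (prodBernoulli (Function.update (Function.update (Function.update (Function.update w s(v, b) 0) s(v, b') 0) s(u, a) 0) s(u, a') 0)).real ((fun ω : BondConfig (Fin n) => insert s(v, b) (insert s(v, b') ω)) ⁻¹' {ω : BondConfig (Fin n) | (A.filter fun z => ω ∈ openConn b z).card ≤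 j}) + (((w s(u, a) : ℝ) * w s(u, a')) * ((w s(v, b) : ℝ) * w s(v, b'))) * (prodBernoulli (Function.update (Function.update (Function.update (Function.update w s(v, b) 0) s(v, b') 0) s(u, a) 0) s(u, a') 0)).real ((fun ω : BondConfig (Fin n) => insert s(u, a) (insert s(u, a') (insert s(v, b) (insert s(v, b') ω)))) ⁻¹' {ω : BondConfig (Fin n) | (A.filter fun z => ω ∈ openConn b z).card ≤ j})) := by
    have h := sub_nonneg.2 hKb
    rw [e1c, e1b, PU, PU, PV, PV, PW, PW] at h
    linarith
  have hint := lincomb_nonneg_of_ae (Function.update (Function.update (Function.update (Function.update w s(v, b) 0) s(v, b') 0) s(u, a) 0) s(u, a') 0) _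
    (certificate_ae w A u v a a' b b' c j hj hu hv huv ha ha' hb hb' hc haa' hbb' hab hab' ha'b ha'b' hca hca' hcb hcb' hutwo hvtwo)
  simp only [List.map_cons, List.map_nil, List.sum_cons, List.sum_nil] at hint
  rw [PU {ω : BondConfig (Fin n) | (A.filter fun z => ω ∈ openConn c z).card ≤ j}, PU {ω : BondConfig (Fin n) | 1 ≤ (A.filter fun z => ω ∈ openConn u z).card ∧ (A.filter fun z => ω ∈ openConn u z).card ≤ j}, PV {ω : BondConfig (Fin n) | ω ∉ openConn c u ∧ ω ∉ openConn c v ∧ (A.filter fun z => ω ∈ openConn c z).card ≤ j}, PV {ω : BondConfig (Fin n) | ω ∉ openConn c u ∧ ω ∉ openConn c v ∧ 1 ≤ (A.filter fun z => ω ∈ openConn u z ∨ ω ∈ openConn v z).card ∧ (A.filter fun z => ω ∈ openConn u z ∨ ω ∈ openConn v z).card ≤ j}, PW {ω : BondConfig (Fin n) | ω ∉ openConn c u ∧ ω ∉ openConn c v ∧ (A.filter fun z => ω ∈ openConn c z).card ≤ j}, PW {ω : BondConfig (Fin n) | ω ∉ openConn c u ∧ ω ∉ openConn c v ∧ 1 ≤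 (A.filter fun z => ω ∈ openConn u z ∨ ω ∈ openConn v z).card ∧ (A.filter fun z => ω ∈ openConn u z ∨ ω ∈ openConn v z).card ≤ j}]
  linarith [hint, mul_nonneg ht0 hKa', mul_nonneg (mul_nonneg hs0 (sub_nonneg.2 ht1)) hKb']

end TwoPortPeeling

end Summit.CriticalPhenomena.PercolationContinuityZ3.Theorems
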